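import Mathlib

/-!
# Mosco convergence of moving linear constraints via a bounded right inverse
(solo-blind AnomalousDissipation, paper §24.31(2)(b); kernel #87)

Abstract core of the constraint-convergence step of §24.31(2)(b).  There the
constrained test spaces are `X_⊥^{b_k} = ker L_k`, `L_k χ = (I ↦ ∮_{L_I} χ ϱ_k dl₀)`
(leaf-wise arc-length means pulled back to the carrier foliation), the `L_k`
converge pointwise because the arc-length ratios `ϱ_k` converge boundedly a.e.
together with their `I`-derivatives, and multiplication by `u / m_k(I)` with
`m_k = ∮ u ϱ_k dl₀ ≥ c > 0` is a right inverse `R_k` of `L_k` with `‖R_k‖ ≤ C`.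
The two halves of Mosco convergence `ker L_k → ker L_∞` then need nothing else:

* (upper / recovery half) for every `η ∈ ker L_∞` the CORRECTOR
  `η_k := η - R_k (L_k η)` lies in `ker L_k` and `η_k → η` strongly
  (`moscoCorrector_mem_ker`, `moscoCorrector_tendsto`, `mosco_recovery`);
* (lower / closedness half) if `η_k ∈ ker L_k`, `η_k → η` and the `L_k` are
  uniformly bounded and converge pointwise to `L_∞`, then `η ∈ ker L_∞`
  (`mosco_closed`).

Everything is over a general `RCLike` field and arbitrary normed spaces; no
completeness is used.
-/

namespace Summit.AnomalousDissipation.AnomalousDissipation.Theorems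

open Filter Topology

section Mosco

variable {𝕜 : Type*} [RCLike 𝕜] {H V : Type*} [NormedAddCommGroup H] [NormedSpace 𝕜 H]
  [NormedAddCommGroup V] [NormedSpace 𝕜 V]

/-- The corrector `η_k = η - R_k (L_k η)`. -/
def moscoCorrector (L : ℕ → H →L[𝕜] V) (R : ℕ → V →L[𝕜] H) (η : H) (k : ℕ) : H :=
  η - R k (L k η)

/-- The corrector satisfies the `k`-th constraint exactly, as soon as `R_k` is a right
inverse of `L_k`. -/
theorem moscoCorrector_mem_ker (L : ℕ → H →L[𝕜] V) (R : ℕ → V →L[𝕜] H)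
    (hRL : ∀ k v, L k (R k v) = v) (η : H) (k : ℕ) :
    L k (moscoCorrector L R η k) = 0 := by
  simp [moscoCorrector, map_sub, hRL]

/-- If the right inverses are uniformly bounded and `L_k η → 0`, the corrector converges
to `η`. -/
theorem moscoCorrector_tendsto (L : ℕ → H →L[𝕜] V) (R : ℕ → V →L[𝕜] H) (η : H)
    (C : ℝ) (hR : ∀ k, ‖R k‖ ≤ C) (hL : Tendsto (fun k => L k η) atTop (𝓝 0)) :
    Tendsto (fun k => moscoCorrector L R η k) atTop (𝓝 η) := by
  have hL' : Tendsto (fun k => ‖L k η‖) atTop (𝓝 0) := by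
    simpa using (tendsto_zero_iff_norm_tendsto_zero.mp hL)
  have h1 : Tendsto (fun k => R k (L k η)) atTop (𝓝 0) := by
    rw [tendsto_zero_iff_norm_tendsto_zero]
    have hup : Tendsto (fun k => max C 0 * ‖L k η‖) atTop (𝓝 0) := by
      simpa using hL'.const_mul (max C 0)
    refine squeeze_zero (fun k => norm_nonneg _) (fun k => ?_) hup
    calc ‖R k (L k η)‖ ≤ ‖R k‖ * ‖L k η‖ := (R k).le_opNorm _
      _ ≤ max C 0 * ‖L k η‖ := by
          gcongr
          exact (hR k).trans (le_max_left _ _)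
  have h2 : Tendsto (fun k => η - R k (L k η)) atTop (𝓝 (η - 0)) :=
    tendsto_const_nhds.sub h1
  simpa [moscoCorrector] using h2

/-- Recovery (upper) half of Mosco convergence of the kernels: every element of the limit
kernel is a strong limit of elements of the moving kernels.  Hypotheses: bounded right
inverses and pointwise convergence of `L_k` to `L∞` at `η`. -/
theorem mosco_recovery (L : ℕ → H →L[𝕜] V) (Linf : H →L[𝕜] V) (R : ℕ → V →L[𝕜] H)
    (hRL : ∀ k v, L k (R k v) = v) (C : ℝ) (hR : ∀ k, ‖R k‖ ≤ C)
    (η : H) (hη : Linf η = 0) (hL : Tendsto (fun k => L k η) atTop (𝓝 (Linf η))) :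
    ∃ ηs : ℕ → H, (∀ k, L k (ηs k) = 0) ∧ Tendsto ηs atTop (𝓝 η) := by
  refine ⟨moscoCorrector L R η, moscoCorrector_mem_ker L R hRL η, ?_⟩
  rw [hη] at hL
  exact moscoCorrector_tendsto L R η C hR hL

/-- Closedness (lower) half: strong limits of constrained elements are constrained,
provided the `L_k` are uniformly bounded and converge pointwise to `L∞`. -/
theorem mosco_closed (L : ℕ → H →L[𝕜] V) (Linf : H →L[𝕜] V)
    (C : ℝ) (hB : ∀ k, ‖L k‖ ≤ C) (hL : ∀ x, Tendsto (fun k => L k x) atTop (𝓝 (Linf x)))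
    (ηs : ℕ → H) (η : H) (hη : Tendsto ηs atTop (𝓝 η)) (hker : ∀ k, L k (ηs k) = 0) :
    Linf η = 0 := by
  -- `L_k η_k - L_k η → 0` by uniform boundedness, and `L_k η → L∞ η`; but `L_k η_k = 0`.
  have hdiff : Tendsto (fun k => L k (ηs k) - L k η) atTop (𝓝 0) := by
    rw [tendsto_zero_iff_norm_tendsto_zero]
    have hn : Tendsto (fun k => ‖ηs k - η‖) atTop (𝓝 0) := by
      simpa using (tendsto_iff_norm_sub_tendsto_zero.mp hη)
    have hup : Tendsto (fun k => max C 0 * ‖ηs k - η‖) atTop (𝓝 0) := by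
      simpa using hn.const_mul (max C 0)
    refine squeeze_zero (fun k => norm_nonneg _) (fun k => ?_) hup
    calc ‖L k (ηs k) - L k η‖ = ‖L k (ηs k - η)‖ := by rw [map_sub]
      _ ≤ ‖L k‖ * ‖ηs k - η‖ := (L k).le_opNorm _
      _ ≤ max C 0 * ‖ηs k - η‖ := by
          gcongr
          exact (hB k).trans (le_max_left _ _)
  have hsum : Tendsto (fun k => (L k (ηs k) - L k η) + L k η) atTop (𝓝 (0 + Linf η)) :=
    hdiff.add (hL η)
  have hks : Tendsto (fun k => L k (ηs k)) atTop (𝓝 (Linf η)) := by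
    simpa using hsum
  have hzero : Tendsto (fun k => L k (ηs k)) atTop (𝓝 0) := by
    simp [hker]
  exact tendsto_nhds_unique hks hzero

/-- The two halves together: under bounded right inverses, uniform boundedness and
pointwise convergence `L_k → L∞`, the kernels converge in the sense of Mosco (strong
recovery sequences exist, and strong limits of kernel elements lie in the limit kernel).
In §24.31(2)(b) weak limits are handled by the same closedness argument applied to the
leaf traces, which converge strongly. -/
theorem mosco_kernels (L : ℕ → H →L[𝕜] V) (Linf : H →L[𝕜] V) (R : ℕ → V →L[𝕜] H)
    (hRL : ∀ k v, L k (R k v) = v) (C : ℝ) (hR : ∀ k, ‖R k‖ ≤ C) (hB : ∀ k, ‖L k‖ ≤ C)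
    (hL : ∀ x, Tendsto (fun k => L k x) atTop (𝓝 (Linf x))) :
    (∀ η, Linf η = 0 → ∃ ηs : ℕ → H, (∀ k, L k (ηs k) = 0) ∧ Tendsto ηs atTop (𝓝 η)) ∧
    (∀ (ηs : ℕ → H) (η : H), Tendsto ηs atTop (𝓝 η) → (∀ k, L k (ηs k) = 0) → Linf η = 0) :=
  ⟨fun η hη => mosco_recovery L Linf R hRL C hR η hη (hL η),
   fun ηs η hη hker => mosco_closed L Linf C hB hL ηs η hη hker⟩

/-- Quantitative form used in the paper: the distance from `η ∈ ker L∞` to `ker L_k` is at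
most `‖R_k‖ ‖L_k η‖ = ‖R_k‖ ‖(L_k - L∞) η‖`. -/
theorem moscoCorrector_dist_le (L : ℕ → H →L[𝕜] V) (Linf : H →L[𝕜] V) (R : ℕ → V →L[𝕜] H)
    (η : H) (hη : Linf η = 0) (k : ℕ) :
    ‖moscoCorrector L R η k - η‖ ≤ ‖R k‖ * ‖(L k - Linf) η‖ := by
  have : moscoCorrector L R η k - η = -(R k (L k η)) := by
    simp [moscoCorrector]
  rw [this, norm_neg, sub_apply, hη, sub_zero]
  exact (R k).le_opNorm _

end Mosco

end Summit.AnomalousDissipation.AnomalousDissipation.Theorems
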